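import Summits.AtomisticToContinuum.Crystallization.Theses.NashClassCertificates
import Summits.AtomisticToContinuum.Crystallization.Theses.PhononSlackCertificates
import Summits.AtomisticToContinuum.Crystallization.Theorems.PhononSlackCertificatesCoerciveTwoShellGapBlocks
import Summits.AtomisticToContinuum.Crystallization.Theorems.HullMinimalityLayeredWindowsReductions

/-!
# Crux `NashTwoShellGap` (stmt-AtomisticToContinuum-16826), line `birth`: the crux and its jammed
# stub are implied by the all-configuration two-shell gap (stmt-13956) and by its torus form

Kernel-checked bookkeeping for the lead's stub `stub_jammedBadGap` (line `birth`,
`Cruxes/NashTwoShellGap/Lines/birth.lean`): the Nash-class crux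

  `NashTwoShellGap : ∃ g > 0, ∀ N x, 1/3-separated → Nash → N·e* + g·#bad ≤ 𝓔_LJ(x)`

is the all-configuration crux `PhononSlackCertificates.CoerciveTwoShellGap` (stmt-13956) with one
extra hypothesis, hence follows from it (the landed
`LayeredWindowsLocal.nashTwoShellGap_of_coerciveTwoShellGap`, reused here), from its
`δ = 1/3` instance (`nashTwoShellGap_of_sepTwoShellGap`) and — through the tree theorem
`CoerciveTwoShellGapBlocks.coerciveTwoShellGap_iff_torusTwoShellGap` — from the TWO-SHELL GAP ON
THE TORUS at tolerance `1/20` (`nashTwoShellGap_of_torusTwoShellGap`), the residual core the lead of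
crux 13956 isolated (`Cruxes/CoerciveTwoShellGap/PICKED.md`).  The same holds for the jammed-bad
gap of line `birth` (`jammedBadGap_of_coerciveTwoShellGap`, `jammedBadGap_of_torusTwoShellGap`):
its count is a sub-count of the bad count and its class (1/2-separated Nash) a sub-class.
So every proof of the shared torus item closes this crux; conversely a refutation of this crux
refutes 13956 and the torus gap (contrapositive, `not_coerciveTwoShellGap_of_not_nashTwoShellGap`).
No definitions; all `[folklore]`.
-/

noncomputable section

namespace Summit.AtomisticToContinuum.Crystallization.Theorems.NashTwoShellGapReductions

open scoped BigOperators Classical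
open Literature.MathematicalPhysics.StatisticalMechanics Literature.Geometry.DiscreteGeometry
open Summit.AtomisticToContinuum.Crystallization.Theses

/-- **Nash crux ⇐ the `1/3`-separated finite two-shell gap** (the `δ = 1/3` instance of
stmt-13956, no Nash hypothesis): drop the Nash hypothesis. [folklore] -/
theorem nashTwoShellGap_of_sepTwoShellGap
    (h : ∃ g : ℝ, 0 < g ∧ ∀ (N : ℕ) (x : Fin N → EuclideanSpace ℝ (Fin 3)),
      (∀ i j : Fin N, i ≠ j → (1 / 3 : ℝ) ≤ dist (x i) (x j)) →
      (N : ℝ) * (⨅ Q : PeriodicConfiguration 3, Q.energyPerParticle lennardJones)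
        + g * (Nat.card {i : Fin N // ¬ IsTwoShellGood (1 / 20) (47 / 50) 1 x i} : ℝ)
        ≤ interactionEnergy lennardJones x) :
    NashClassCertificates.NashTwoShellGap := by
  obtain ⟨g, hg, h⟩ := h
  exact ⟨g, hg, fun N x hsep _ => h N x hsep⟩

/-- Contrapositive bookkeeping: `¬ NashTwoShellGap → ¬ CoerciveTwoShellGap`. [folklore] -/
theorem not_coerciveTwoShellGap_of_not_nashTwoShellGap (h : ¬ NashClassCertificates.NashTwoShellGap) :
    ¬ PhononSlackCertificates.CoerciveTwoShellGap :=
  fun h' => h (LayeredWindowsLocal.nashTwoShellGap_of_coerciveTwoShellGap h')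

/-- **Nash crux ⇐ the two-shell gap on the torus** (tolerance `1/20`, `1/3`-separated periodic
configurations; the shared residual core of crux 13956): through
`coerciveTwoShellGap_iff_torusTwoShellGap`. [folklore] -/
theorem nashTwoShellGap_of_torusTwoShellGap
    (h : ∃ g : ℝ, 0 < g ∧ ∀ P : PeriodicConfiguration 3,
      (∀ u ∈ P.points, ∀ v ∈ P.points, u ≠ v → (1 / 3 : ℝ) ≤ dist u v) →
      (⨅ Q : PeriodicConfiguration 3, Q.energyPerParticle lennardJones)
        + g * ((P.motif.filter fun y => ¬ IsTwoShellGoodSet (1 / 20) (47 / 50) 1 P.points y).card : ℝ)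
            / (P.motif.card : ℝ)
        ≤ P.energyPerParticle lennardJones) :
    NashClassCertificates.NashTwoShellGap :=
  LayeredWindowsLocal.nashTwoShellGap_of_coerciveTwoShellGap
    (CoerciveTwoShellGapBlocks.coerciveTwoShellGap_iff_torusTwoShellGap.2 h)

/-- A sub-count of the bad particles: restricting the bad set by any second predicate does not
increase its cardinality. [folklore] -/
theorem natCard_bad_and_le {N : ℕ} (B E : Fin N → Prop) :
    Nat.card {i : Fin N // B i ∧ E i} ≤ Nat.card {i : Fin N // B i} :=
  Nat.card_le_card_of_injective (fun a : {i : Fin N // B i ∧ E i} => (⟨a.1, a.2.1⟩ : {i : Fin N // B i}))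
    (fun _ _ hab => Subtype.ext (congrArg (fun c : {i : Fin N // B i} => c.1) hab))

/-- **The jammed-bad gap of line `birth` ⇐ `CoerciveTwoShellGap`**: instantiate `δ := 1/2`,
drop the Nash hypothesis and bound the jammed-bad count by the bad count. [folklore] -/
theorem jammedBadGap_of_coerciveTwoShellGap (h : PhononSlackCertificates.CoerciveTwoShellGap) :
    ∃ g : ℝ, 0 < g ∧ ∀ (N : ℕ) (x : Fin N → EuclideanSpace ℝ (Fin 3)),
      (∀ i j : Fin N, i ≠ j → 1 / 2 ≤ dist (x i) (x j)) →
      (∀ (i : Fin N) (y : EuclideanSpace ℝ (Fin 3)), (∀ j : Fin N, j ≠ i → y ≠ x j) →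
        siteEnergy lennardJones x i ≤ ∑ j ∈ Finset.univ.erase i, lennardJones (dist y (x j))) →
      (N : ℝ) * (⨅ Q : PeriodicConfiguration 3, Q.energyPerParticle lennardJones)
        + g * (Nat.card {i : Fin N // ¬ IsTwoShellGood (1 / 20) (47 / 50) 1 x i ∧
            ¬ ∃ p : EuclideanSpace ℝ (Fin 3), dist p (x i) ≤ 6 / 5 ∧ ∀ j : Fin N, 9 / 10 ≤ dist p (x j)} : ℝ)
        ≤ interactionEnergy lennardJones x := by
  obtain ⟨g, hg, hG⟩ := h (1 / 2) (by norm_num)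
  refine ⟨g, hg, fun N x hsep _ => ?_⟩
  have hle : (Nat.card {i : Fin N // ¬ IsTwoShellGood (1 / 20) (47 / 50) 1 x i ∧
      ¬ ∃ p : EuclideanSpace ℝ (Fin 3), dist p (x i) ≤ 6 / 5 ∧ ∀ j : Fin N, 9 / 10 ≤ dist p (x j)} : ℝ)
      ≤ (Nat.card {i : Fin N // ¬ IsTwoShellGood (1 / 20) (47 / 50) 1 x i} : ℝ) := by
    exact_mod_cast natCard_bad_and_le _ _
  have := hG N x hsep
  nlinarith [mul_le_mul_of_nonneg_left hle hg.le]

/-- **The jammed-bad gap of line `birth` ⇐ the two-shell gap on the torus.** [folklore] -/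
theorem jammedBadGap_of_torusTwoShellGap
    (h : ∃ g : ℝ, 0 < g ∧ ∀ P : PeriodicConfiguration 3,
      (∀ u ∈ P.points, ∀ v ∈ P.points, u ≠ v → (1 / 3 : ℝ) ≤ dist u v) →
      (⨅ Q : PeriodicConfiguration 3, Q.energyPerParticle lennardJones)
        + g * ((P.motif.filter fun y => ¬ IsTwoShellGoodSet (1 / 20) (47 / 50) 1 P.points y).card : ℝ)
            / (P.motif.card : ℝ)
        ≤ P.energyPerParticle lennardJones) :
    ∃ g : ℝ, 0 < g ∧ ∀ (N : ℕ) (x : Fin N → EuclideanSpace ℝ (Fin 3)),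
      (∀ i j : Fin N, i ≠ j → 1 / 2 ≤ dist (x i) (x j)) →
      (∀ (i : Fin N) (y : EuclideanSpace ℝ (Fin 3)), (∀ j : Fin N, j ≠ i → y ≠ x j) →
        siteEnergy lennardJones x i ≤ ∑ j ∈ Finset.univ.erase i, lennardJones (dist y (x j))) →
      (N : ℝ) * (⨅ Q : PeriodicConfiguration 3, Q.energyPerParticle lennardJones)
        + g * (Nat.card {i : Fin N // ¬ IsTwoShellGood (1 / 20) (47 / 50) 1 x i ∧
            ¬ ∃ p : EuclideanSpace ℝ (Fin 3), dist p (x i) ≤ 6 / 5 ∧ ∀ j : Fin N, 9 / 10 ≤ dist p (x j)} : ℝ)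
        ≤ interactionEnergy lennardJones x :=
  jammedBadGap_of_coerciveTwoShellGap
    (CoerciveTwoShellGapBlocks.coerciveTwoShellGap_iff_torusTwoShellGap.2 h)

/-- **The crux ⇒ the jammed-bad gap** (so the jammed stub is sandwiched between the crux and the
torus gap's consequences: it is a consequence of the crux with a smaller count on the smaller
`1/2`-separated class). [folklore] -/
theorem jammedBadGap_of_nashTwoShellGap (h : NashClassCertificates.NashTwoShellGap) :
    ∃ g : ℝ, 0 < g ∧ ∀ (N : ℕ) (x : Fin N → EuclideanSpace ℝ (Fin 3)),
      (∀ i j : Fin N, i ≠ j → 1 / 2 ≤ dist (x i) (x j)) →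
      (∀ (i : Fin N) (y : EuclideanSpace ℝ (Fin 3)), (∀ j : Fin N, j ≠ i → y ≠ x j) →
        siteEnergy lennardJones x i ≤ ∑ j ∈ Finset.univ.erase i, lennardJones (dist y (x j))) →
      (N : ℝ) * (⨅ Q : PeriodicConfiguration 3, Q.energyPerParticle lennardJones)
        + g * (Nat.card {i : Fin N // ¬ IsTwoShellGood (1 / 20) (47 / 50) 1 x i ∧
            ¬ ∃ p : EuclideanSpace ℝ (Fin 3), dist p (x i) ≤ 6 / 5 ∧ ∀ j : Fin N, 9 / 10 ≤ dist p (x j)} : ℝ)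
        ≤ interactionEnergy lennardJones x := by
  obtain ⟨g, hg, hG⟩ := h
  refine ⟨g, hg, fun N x hsep hnash => ?_⟩
  have hsep3 : ∀ i j : Fin N, i ≠ j → (1 / 3 : ℝ) ≤ dist (x i) (x j) :=
    fun i j hij => le_trans (by norm_num) (hsep i j hij)
  have hle : (Nat.card {i : Fin N // ¬ IsTwoShellGood (1 / 20) (47 / 50) 1 x i ∧
      ¬ ∃ p : EuclideanSpace ℝ (Fin 3), dist p (x i) ≤ 6 / 5 ∧ ∀ j : Fin N, 9 / 10 ≤ dist p (x j)} : ℝ)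
      ≤ (Nat.card {i : Fin N // ¬ IsTwoShellGood (1 / 20) (47 / 50) 1 x i} : ℝ) := by
    exact_mod_cast natCard_bad_and_le _ _
  have := hG N x hsep3 hnash
  nlinarith [mul_le_mul_of_nonneg_left hle hg.le]

/-- **Registered sub-goal `stub_jammedOfTorusGap`** (lead, line `birth`; bookkeeping, not part
of the composition `NashTwoShellGap_of`): the two-shell gap on the torus at tolerance `1/20`
implies the line's jammed-bad gap on the Nash class — the hardest stub is a consequence of the
shared residual core of crux 13956. [folklore] -/
theorem stub_jammedOfTorusGap : (∃ g : ℝ, 0 < g ∧ ∀ P : Literature.MathematicalPhysics.StatisticalMechanics.PeriodicConfiguration 3, (∀ u ∈ P.points, ∀ v ∈ P.points, u ≠ v → (1 / 3 : ℝ) ≤ dist u v) → (⨅ Q : Literature.MathematicalPhysics.StatisticalMechanics.PeriodicConfiguration 3, Q.energyPerParticle Literature.MathematicalPhysics.StatisticalMechanics.lennardJones) + g * ((P.motif.filter fun y => ¬ Literature.Geometry.DiscreteGeometry.IsTwoShellGoodSet (1 / 20) (47 / 50) 1 P.points y).card : ℝ) / (P.motif.card : ℝ) ≤ P.energyPerParticle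 Literature.MathematicalPhysics.StatisticalMechanics.lennardJones) → ∃ g : ℝ, 0 < g ∧ ∀ (N : ℕ) (x : Fin N → EuclideanSpace ℝ (Fin 3)), (∀ i j : Fin N, i ≠ j → 1 / 2 ≤ dist (x i) (x j)) → (∀ (i : Fin N) (y : EuclideanSpace ℝ (Fin 3)), (∀ j : Fin N, j ≠ i → y ≠ x j) → Literature.MathematicalPhysics.StatisticalMechanics.siteEnergy Literature.MathematicalPhysics.StatisticalMechanics.lennardJones x i ≤ ∑ j ∈ Finset.univ.erase i, Literature.MathematicalPhysics.StatisticalMechanics.lennardJones (dist y (x j))) → (N : ℝ) * (⨅ Q : Literature.MathematicalPhysics.StatisticalMechanics.PeriodicConfiguration 3, Q.energyPerParticle Literature.MathematicalPhysics.StatisticalMechanics.lennardJones) + g * (Nat.card {i : Fin N // ¬ Literature.Geometry.DiscreteGeometry.IsTwoShellGood (1 / 20) (47 / 50) 1 x i ∧ ¬ ∃ p : EuclideanSpace ℝ (Fin 3), dist p (x i) ≤ 6 / 5 ∧ ∀ j : Fin N, 9 / 10 ≤ dist p (x j)} : ℝ) ≤ Literature.MathematicalPhysics.StatisticalMechanics.interactionEnergy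 Literature.MathematicalPhysics.StatisticalMechanics.lennardJones x :=
  jammedBadGap_of_torusTwoShellGap

end Summit.AtomisticToContinuum.Crystallization.Theorems.NashTwoShellGapReductions

end
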